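import Mathlib
import Summits.Ventures.PercRepro2.PMK5Deg3Kernel
import Summits.Ventures.PercRepro2.PMK5Deg3LitsOA1U

/-!
# The slice certificates of the triple `(o, a₁, u) = (0, 1, 3)`, part 2: the slices `(1, 0), (1, 1), (1, 2), (1, 3)`
(blind cell PercRepro2, mine-2 g27; `PMK5Deg3Kernel.lean`, literals `PMK5Deg3LitsOA1U.lean`)

One `decide +kernel` per slice `(j₁, j₂)` of the profile digits of the `a₃`-edges `11`, `12`: `kNegS ≤ kPosS`,
`Nat.land (kPosS − kNegS) mask = 0`, `Nat.land kNegS mask = 0` on the `4^11`-digit slice numbers built from the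
table literals — every typed three-copy class sum of `K₃` on `K₅ + {a₃o, a₃a₁, a₃u}` with those two digits is `≥ 0`.
Census twin: kit j260972 (M2-63, two own codes, 0 negative class sums on every triple).
-/

namespace Summit.Ventures.PercRepro2

namespace Deg3

set_option maxHeartbeats 0 in
set_option maxRecDepth 100000 in
/-- The slice `(1, 0)` of the triple `(0, 1, 3)`. -/
theorem certS_oa1u_10 : CertS Loa1u 1 0 := by
  unfold CertS
  decide +kernel

set_option maxHeartbeats 0 in
set_option maxRecDepth 100000 in
/-- The slice `(1, 1)` of the triple `(0, 1, 3)`. -/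
theorem certS_oa1u_11 : CertS Loa1u 1 1 := by
  unfold CertS
  decide +kernel

set_option maxHeartbeats 0 in
set_option maxRecDepth 100000 in
/-- The slice `(1, 2)` of the triple `(0, 1, 3)`. -/
theorem certS_oa1u_12 : CertS Loa1u 1 2 := by
  unfold CertS
  decide +kernel

set_option maxHeartbeats 0 in
set_option maxRecDepth 100000 in
/-- The slice `(1, 3)` of the triple `(0, 1, 3)`. -/
theorem certS_oa1u_13 : CertS Loa1u 1 3 := by
  unfold CertS
  decide +kernel

end Deg3

end Summit.Ventures.PercRepro2
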